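import Summits.CriticalPhenomena.Ising3DConformalLimit.Theses.ModularQuarterTurn
import HarnessLib

/-!
# Route `ModularQuarterTurn`, crux #4 `(E₀)` = shared item stmt-CriticalPhenomena-1981 — the split assembly BY NAME

Crux-strategist r1 (instance ModularQuarterTurn), BC2-REDIRECT certificate of the RESTATED deciding crux
`Theses.ModularQuarterTurn.ExistsScaleCovariantLimit` (item stmt-CriticalPhenomena-1981). The route-level split (gen 1,
2026-08-17T12:33Z) made the two kernel-certified halves the route's leaves:

* `Theses.ModularQuarterTurn.TwoPointDoubling` = item stmt-CriticalPhenomena-6150 verbatim (compactness half: all-scale doubling of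
  the axial critical two-point function on `ℤ³`, Aizenman–Duminil-Copin 2021, Remark 5.10 — open);
* `Theses.ModularQuarterTurn.ClusterSetTotallyDisconnected` = item stmt-CriticalPhenomena-4659 verbatim (identification half: the cluster
  set of the self-normalised critical family is totally disconnected — open).

This file states the ASSEMBLY of that decomposition at the route's own decls, by name, in the three shapes a reader may look for —
curried `X₁ → X₂ → X`, uncurried `X₁ ∧ X₂ → X`, and the exactness `X ↔ X₁ ∧ X₂` (the split loses nothing) — all one-line compositions of
landed theorems: the gate-rendered glue `Theses.ModularQuarterTurn.ExistsScaleCovariantLimitGlueBy_holds` (=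
`SplitGlue.hrp_crux_of_doubling_of_totallyDisconnected`, p154899) and `FoldedCurrentRepulsion.crux_iff_doubling_and_totallyDisconnected`
(p139907), accepted at this route's copies by `δ`-unfolding (every route copy of the three decls has one body). No definitions, no `sorry`.

References: H. Duminil-Copin, ICM 2022 §8.4 [DuminilCopinICM2022]; M. Aizenman, H. Duminil-Copin, Ann. of Math. 194 (2021),
arXiv:1912.07973, Remark 5.10 [AizenmanDuminilCopinAnnals2021].
-/

namespace Summit.CriticalPhenomena.Ising3DConformalLimit.Cruxes.ExistsScaleCovariantLimit.ModularQuarterTurnSplit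

open Summit.CriticalPhenomena.Ising3DConformalLimit.Theses

/-- **Assembly (curried)**: the two pieces give route `ModularQuarterTurn`'s crux `(E₀)` by name. [folklore] -/
theorem ExistsScaleCovariantLimit_of_subs :
    ModularQuarterTurn.TwoPointDoubling → ModularQuarterTurn.ClusterSetTotallyDisconnected →
      ModularQuarterTurn.ExistsScaleCovariantLimit :=
  ModularQuarterTurn.ExistsScaleCovariantLimitGlueBy_holds

/-- **Assembly (uncurried)** `X₁ ∧ X₂ → X` — the human ruling's shape; the seam is modus ponens (`trivial_seam`). [folklore] -/
theorem ExistsScaleCovariantLimit_of_subs_and :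
    ModularQuarterTurn.TwoPointDoubling ∧ ModularQuarterTurn.ClusterSetTotallyDisconnected →
      ModularQuarterTurn.ExistsScaleCovariantLimit :=
  fun h => ExistsScaleCovariantLimit_of_subs h.1 h.2

/-- **Exactness**: the decomposition is lossless — the crux is EQUIVALENT to the conjunction of its two pieces (p139907 at this
route's copies). [folklore] -/
theorem ExistsScaleCovariantLimit_iff_subs :
    ModularQuarterTurn.ExistsScaleCovariantLimit ↔
      (ModularQuarterTurn.TwoPointDoubling ∧ ModularQuarterTurn.ClusterSetTotallyDisconnected) :=
  _root_.Summit.CriticalPhenomena.Ising3DConformalLimit.Cruxes.ExistsScaleCovariantLimit.FoldedCurrentRepulsion.crux_iff_doubling_and_totallyDisconnected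

end Summit.CriticalPhenomena.Ising3DConformalLimit.Cruxes.ExistsScaleCovariantLimit.ModularQuarterTurnSplit
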